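import Summits.ResolutionOfSingularities.ResolutionOfSingularities.Theorems.PurelyInseparableDim4SpineOrthant
import HarnessLib
import HarnessLib.Audit.Tags

/-!
# Purely inseparable fourfolds — the DEGREE LAW of a spine move and the DROPPING WITNESS of cardinality-first

Census cell «res-dim4-pi» (D-0157 DOOR 2), seat res-dim4-p-8 (Q-CF∀ consortium notes F2 / F5 of
`HOME/res-dim4-p-7/QCF-MEMO.md`, res-dim4-p-7, typed here).  [OURS · counted 0 · AI kernel work, weaker
than expert review.]  Nothing here is about resolution of singularities itself; nothing here proves
resolution in dimension ≥ 4 / characteristic `p`.  DEF-FREE, vocabulary of `PurelyInseparableDim4SpineGame`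
(imports `…SpineOrthant` for «least cardinality ⇒ inclusion-minimal»).

For a move `(J, j)` of Hironaka's pure game on a position `A` (threshold `q`), every monomial `a` goes to
`a' = chartExponent q J j a` with the DEGREE LAW `|a'| + q = |a| + Σ_{i ∈ J∖j} aᵢ` (tree:
`Perm2Bound.degree_chartExponent_add`).  Hence (§1) `a` DROPS (`|a'| < |a|`) iff `Σ_{J∖j} aᵢ < q`, is
STATIONARY iff `= q`, RISES iff `> q`; and (§2) if `J` is INCLUSION-MINIMAL among the permissible centres of
the position — in particular if it is CARDINALITY-FIRST (least `|J|`, the support shadow of the cell's MODE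
1h, any tie-breaking) — then for EVERY chart `j ∈ J` some monomial of `A` drops strictly: the witness of the
impermissibility of `J ∖ j` (or every monomial, when `J = {j}`).  So (§3) along every play of every
cardinality-first strategy, at every single move at least one monomial loses total degree (`0 < q`): player B
can only survive by making OTHER monomials rise.  This is the structural half of the open census question
Q-CF∀ (boards/ROUTES.md WORD #28 (d)); it is not a termination proof.

[cite: Spivakovsky1983, §1 (Hironaka's polyhedra game: permissible sets, the move)]
bears_on: LADDER-RESOLUTION:D157-DOOR2 (res-dim4-pi · Q-CF∀). Supports stmt-ResolutionOfSingularities-16155 (helper).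
-/

-- cell convention (DR-157-C): the summit's doubled path segment is intended, as in the landed Target file
set_option linter.dupNamespace false

namespace Summit.ResolutionOfSingularities.ResolutionOfSingularities.Theorems.PIDim4.SpineDrop

open Finset
open Literature.AlgebraicGeometry.Resolution
open Literature.AlgebraicGeometry.Resolution.CentreBlowup

/-! ## 1. The degree law: drop / stationary / rise -/

/-- **Drop criterion.**  Under a move `(J, j)` with `j ∈ J` and `q ≤ Σ_J a`, the monomial `a` loses total
degree iff `Σ_{i∈J∖j} aᵢ < q`. [folklore] -/
theorem degree_chartExponent_lt_iff {q : ℕ} {J : Finset (Fin 4)} {j : Fin 4} (hj : j ∈ J)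
    {a : Fin 4 →₀ ℕ} (ha : q ≤ degIn J a) :
    (chartExponent q J j a).degree < a.degree ↔ degIn (J.erase j) a < q := by
  have h := Perm2Bound.degree_chartExponent_add hj ha
  omega

/-- **Stationary criterion**: the degree is unchanged iff `Σ_{i∈J∖j} aᵢ = q`. [folklore] -/
theorem degree_chartExponent_eq_iff {q : ℕ} {J : Finset (Fin 4)} {j : Fin 4} (hj : j ∈ J)
    {a : Fin 4 →₀ ℕ} (ha : q ≤ degIn J a) :
    (chartExponent q J j a).degree = a.degree ↔ degIn (J.erase j) a = q := by
  have h := Perm2Bound.degree_chartExponent_add hj ha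
  omega

/-- **Rise criterion**: the degree grows iff `Σ_{i∈J∖j} aᵢ > q`. [folklore] -/
theorem lt_degree_chartExponent_iff {q : ℕ} {J : Finset (Fin 4)} {j : Fin 4} (hj : j ∈ J)
    {a : Fin 4 →₀ ℕ} (ha : q ≤ degIn J a) :
    a.degree < (chartExponent q J j a).degree ↔ q < degIn (J.erase j) a := by
  have h := Perm2Bound.degree_chartExponent_add hj ha
  omega

/-- Under a singleton centre `{j}` every monomial loses exactly `q`. [folklore] -/
theorem degree_chartExponent_singleton_add {q : ℕ} {j : Fin 4} {a : Fin 4 →₀ ℕ}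
    (ha : q ≤ degIn {j} a) :
    (chartExponent q {j} j a).degree + q = a.degree := by
  have h := Perm2Bound.degree_chartExponent_add (Finset.mem_singleton_self j) ha
  rw [Finset.erase_singleton, degIn_empty] at h
  omega

/-! ## 2. The dropping witness of an inclusion-minimal / cardinality-first centre -/

/-- **Dropping witness (inclusion-minimal centre).**  If `J` is permissible at the not-yet-won position `A`,
no proper nonempty subset of `J` is permissible, and `j ∈ J`, then some monomial of `A` drops strictly under
the move `(J, j)` (`0 < q`). [folklore] -/
theorem exists_degree_lt_of_minimal {q : ℕ} (hq : 0 < q) {J : Finset (Fin 4)} {j : Fin 4} {A : SpinePos}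
    (hA : ¬ SpineWon q A) (hperm : SpinePermissible q J A)
    (hmin : ∀ J' : Finset (Fin 4), J' ⊂ J → ¬ SpinePermissible q J' A) (hj : j ∈ J) :
    ∃ a ∈ A, (chartExponent q J j a).degree < a.degree := by
  by_cases hne : (J.erase j).Nonempty
  · -- `J ∖ j` is a proper nonempty subset, hence not permissible: a witness monomial has small `(J∖j)`-degree
    have hnp := hmin _ (Finset.erase_ssubset hj)
    have hex : ∃ a ∈ A, degIn (J.erase j) a < q := by
      by_contra hcon
      apply hnp
      refine ⟨hne, fun a ha => ?_⟩
      by_contra hlt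
      exact hcon ⟨a, ha, Nat.lt_of_not_le hlt⟩
    obtain ⟨a, ha, hlt⟩ := hex
    exact ⟨a, ha, (degree_chartExponent_lt_iff hj (hperm.2 a ha)).mpr hlt⟩
  · -- `J = {j}`: every monomial loses `q`; the position is nonempty since it is not won
    rw [Finset.not_nonempty_iff_eq_empty] at hne
    have hAne : A.Nonempty := by
      rw [Finset.nonempty_iff_ne_empty]
      exact fun h => hA (Or.inl h)
    obtain ⟨a, ha⟩ := hAne
    refine ⟨a, ha, (degree_chartExponent_lt_iff hj (hperm.2 a ha)).mpr ?_⟩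
    rw [hne, degIn_empty]
    exact hq

/-- **Dropping witness (cardinality-first centre, any tie-breaking).**  If `J` is a permissible centre of
least cardinality at the not-yet-won position `A` and `j ∈ J`, some monomial of `A` drops strictly under
`(J, j)` (`0 < q`). [folklore] -/
theorem exists_degree_lt_of_cardFirst {q : ℕ} (hq : 0 < q) {J : Finset (Fin 4)} {j : Fin 4} {A : SpinePos}
    (hA : ¬ SpineWon q A) (hperm : SpinePermissible q J A)
    (hcard : ∀ J' : Finset (Fin 4), SpinePermissible q J' A → J.card ≤ J'.card) (hj : j ∈ J) :
    ∃ a ∈ A, (chartExponent q J j a).degree < a.degree :=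
  exists_degree_lt_of_minimal hq hA hperm
    (fun _ hJ' => SpineOrthant.not_spinePermissible_of_ssubset_of_cardFirst hcard hJ') hj

/-! ## 3. Along a cardinality-first play some monomial drops at every move -/

/-- **No idle move.**  Along every infinite pure play of every cardinality-first strategy (any tie-breaking),
at EVERY time `n` some monomial of the current position has a chart image of strictly smaller degree in the
next position (`0 < q`). [folklore] -/
theorem exists_drop_of_isPurePlay {q : ℕ} (hq : 0 < q) {σ : SpineStrategy}
    (hσ : ∀ A : SpinePos, ¬ SpineWon q A →
      SpinePermissible q (σ A) A ∧ ∀ J' : Finset (Fin 4), SpinePermissible q J' A → (σ A).card ≤ J'.card)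
    {P : ℕ → SpinePos} (hP : IsPurePlay q σ P) (n : ℕ) :
    ∃ a ∈ P n, ∃ j ∈ σ (P n), P (n + 1) = pureMove q (σ (P n)) j (P n) ∧
      chartExponent q (σ (P n)) j a ∈ P (n + 1) ∧ (chartExponent q (σ (P n)) j a).degree < a.degree := by
  obtain ⟨hnotwon, j, hj, hsucc⟩ := hP n
  obtain ⟨hperm, hcard⟩ := hσ (P n) hnotwon
  obtain ⟨a, ha, hlt⟩ := exists_degree_lt_of_cardFirst hq hnotwon hperm hcard hj
  refine ⟨a, ha, j, hj, hsucc, ?_, hlt⟩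
  rw [hsucc]
  exact Finset.mem_image_of_mem _ ha

/-! ## 4. «B pays»: a no-rise move makes the total degree drop (res-dim4-p-7's one-step sufficient condition) -/

/-- Summing a function over an image is bounded by summing its pull-back (natural-number values). [folklore] -/
theorem sum_image_le_sum {f : (Fin 4 →₀ ℕ) → (Fin 4 →₀ ℕ)} {g : (Fin 4 →₀ ℕ) → ℕ} (A : SpinePos) :
    ∑ b ∈ A.image f, g b ≤ ∑ a ∈ A, g (f a) := by
  rw [Finset.sum_comp g f]
  refine Finset.sum_le_sum fun b hb => ?_
  obtain ⟨a, ha, rfl⟩ := Finset.mem_image.mp hb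
  have hcard : 1 ≤ (A.filter fun a' => f a' = f a).card :=
    Finset.card_pos.mpr ⟨a, Finset.mem_filter.mpr ⟨ha, rfl⟩⟩
  calc g (f a) = 1 • g (f a) := (one_smul ℕ _).symm
    _ ≤ (A.filter fun a' => f a' = f a).card • g (f a) := Nat.mul_le_mul_right _ hcard

/-- **No-rise criterion** (pointwise): if `Σ_{i∈J∖j} aᵢ ≤ q` the monomial `a` does not rise. [folklore] -/
theorem degree_chartExponent_le_of_le {q : ℕ} {J : Finset (Fin 4)} {j : Fin 4} (hj : j ∈ J)
    {a : Fin 4 →₀ ℕ} (ha : q ≤ degIn J a) (hsub : degIn (J.erase j) a ≤ q) :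
    (chartExponent q J j a).degree ≤ a.degree := by
  have h := Perm2Bound.degree_chartExponent_add hj ha
  omega

/-- **«B pays» (one-step form, res-dim4-p-7 QCF-MEMO).**  If `J` is an inclusion-minimal permissible centre of
the not-yet-won position `A` and the chart `j ∈ J` raises nobody (`Σ_{i∈J∖j} aᵢ ≤ q` for every monomial), then
the TOTAL degree of the position drops strictly under `(J, j)` (`0 < q`): nobody rises, the dropping witness
drops, and merging of monomials only helps. [folklore] -/
theorem sum_degree_pureMove_lt {q : ℕ} (hq : 0 < q) {J : Finset (Fin 4)} {j : Fin 4} {A : SpinePos}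
    (hA : ¬ SpineWon q A) (hperm : SpinePermissible q J A)
    (hmin : ∀ J' : Finset (Fin 4), J' ⊂ J → ¬ SpinePermissible q J' A) (hj : j ∈ J)
    (hsub : ∀ a ∈ A, degIn (J.erase j) a ≤ q) :
    ∑ b ∈ pureMove q J j A, b.degree < ∑ a ∈ A, a.degree := by
  refine (sum_image_le_sum A).trans_lt (Finset.sum_lt_sum (fun a ha => ?_) ?_)
  · exact degree_chartExponent_le_of_le hj (hperm.2 a ha) (hsub a ha)
  · exact exists_degree_lt_of_minimal hq hA hperm hmin hj

/-- The same for a CARDINALITY-FIRST centre (any tie-breaking). [folklore] -/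
theorem sum_degree_pureMove_lt_of_cardFirst {q : ℕ} (hq : 0 < q) {J : Finset (Fin 4)} {j : Fin 4}
    {A : SpinePos} (hA : ¬ SpineWon q A) (hperm : SpinePermissible q J A)
    (hcard : ∀ J' : Finset (Fin 4), SpinePermissible q J' A → J.card ≤ J'.card) (hj : j ∈ J)
    (hsub : ∀ a ∈ A, degIn (J.erase j) a ≤ q) :
    ∑ b ∈ pureMove q J j A, b.degree < ∑ a ∈ A, a.degree :=
  sum_degree_pureMove_lt hq hA hperm
    (fun _ hJ' => SpineOrthant.not_spinePermissible_of_ssubset_of_cardFirst hcard hJ') hj hsub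

end Summit.ResolutionOfSingularities.ResolutionOfSingularities.Theorems.PIDim4.SpineDrop
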